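import Mathlib.Data.Nat.Size
import Literature.Computability.Complexity.TwoColouringScan
import Literature.ModelTheory.FiniteModelTheory.CPTCardPTIMETable
import HarnessLib

/-!
# Simulating BGS programs in polynomial time, II: the guarded evaluator and its soundness

Topic `Literature/ModelTheory/FiniteModelTheory`; second support file of the discharge of
`Literature.ModelTheory.FiniteModelTheory.CPTCardInPTIME` (Blass–Gurevich–Shelah 1999, §5.2
Theorem 1: "The desired Turing machine simulates the given PTime program"). On the hash-consed
object tables of `CPTCardPTIMETable.lean` we write the INTERPRETER of the language BGS+`Card`
(`BGSPrograms.lean`) as a first-order functional program: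

* `ev C t ρ S` / `evArgs` — the value (an index) of a term in the state coded by the context `C`
  (number of atoms, adjacency bits of the input graph, the association list `srep` of the
  non-`∅` locations of the dynamic functions, and a BUDGET `B`) under the environment `ρ`
  (association list variable ↦ index), threading the table-with-overflow-flag `S`;
  `den C R ρ S` — the coded update set of a rule; `fireS` — firing it on `srep`
  (Blass–Gurevich–Shelah 1999, §4.4–4.6, clause by clause);
* the RESOURCE GUARD `foldCap`: every data-dependent loop (comprehension, `do forall`, the von
  Neumann ordinal of `Card`) checks before each round that the code length of its accumulator
  (`cT`, `cL`, … — the lengths of the codes `CodeFP` will use) is at most `B`, and otherwise raises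
  the STICKY overflow flag and idles. This is what makes the interpreter polynomial on EVERY input
  (`CPTCardPTIMECodeFP.lean`); that the guard never fires along a genuine run within the bounds
  `(p, q)` is the size analysis of `CPTCardPTIMESize.lean`;
* SOUNDNESS (this file): if the overflow flag is down at the end, the computed index denotes the
  BGS value — `ev_sound` (`val = Term.eval`), `den_sound` (the coded updates decode to `Rule.den`),
  `srel_fireS` (firing coded updates realises `fire`), for canonical tables and states related by
  `SRel`.

## References

* A. Blass, Y. Gurevich, S. Shelah, *Choiceless polynomial time*, Ann. Pure Appl. Logic 100
  (1999) = arXiv:math/9705225, §4.4–4.6 (semantics of terms and rules), §5.2 Theorem 1.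
* A. Blass, Y. Gurevich, S. Shelah, J. Symbolic Logic 67 (2002), §2 (`Card`).
-/

noncomputable section

namespace Literature.ModelTheory.FiniteModelTheory.BGS.Sim

open Literature.Computability.Complexity (TwoColouring.adj TwoColouring.graph TwoColouring.graph_adj)

variable {n : ℕ}

/-! ### Code lengths (the guard's measure) -/

/-- Length of the binary code of a natural (`Nat.size`, = `|natE k|`). [folklore] -/
def cN (k : ℕ) : ℕ := Nat.size k

/-- Length of the code of a list of naturals (`rawE natE`). [folklore] -/
def cL (l : List ℕ) : ℕ := (l.map fun k => 2 * cN k + 2).sum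

/-- Length of the code of a table (`rawE (rawE natE)`). [folklore] -/
def cT (T : List (List ℕ)) : ℕ := (T.map fun e => 2 * cL e + 2).sum

/-- Length of the code of a pair (`pairE`). [folklore] -/
def cP (a b : ℕ) : ℕ := 2 * a + 2 + b

/-- A table together with the (sticky) OVERFLOW FLAG. [folklore] -/
abbrev TS : Type := List (List ℕ) × Bool

/-- Length of the code of a table-with-flag. [folklore] -/
def cTS (S : TS) : ℕ := cP (cT S.1) 1

/-- A coded update / state entry `((f, argument indices), value index)`. [folklore] -/
abbrev CUpdate : Type := (ℕ × List ℕ) × ℕ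

/-- Length of the code of a coded update. [folklore] -/
def cU (u : CUpdate) : ℕ := cP (cP (cN u.1.1) (cL u.1.2)) (cN u.2)

/-- Length of the code of a list of coded updates. [folklore] -/
def cUL (l : List CUpdate) : ℕ := (l.map fun u => 2 * cU u + 2).sum

/-! ### The guarded fold -/

/-- **The guarded fold.** A left fold whose accumulator carries a table-with-flag; before each
round, if the flag is up or the measure `μ` of the accumulator exceeds the budget `B`, the flag is
raised (it is sticky) and the round is skipped. [folklore] -/
def foldCap {α γ : Type} (μ : TS × γ → ℕ) (B : ℕ) (step : α → TS × γ → TS × γ) (init : TS × γ)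
    (l : List α) : TS × γ :=
  l.foldl (fun acc a => if acc.1.2 || decide (B < μ acc) then ((acc.1.1, true), acc.2) else step a acc)
    init

section FoldCap

variable {α γ : Type} (μ : TS × γ → ℕ) (B : ℕ) (step : α → TS × γ → TS × γ)

/-- The guarded fold of the empty list. [folklore] -/
@[simp] theorem foldCap_nil (init : TS × γ) : foldCap μ B step init [] = init := rfl

/-- One round of the guarded fold. [folklore] -/
theorem foldCap_cons (init : TS × γ) (a : α) (l : List α) :
    foldCap μ B step init (a :: l) =
      foldCap μ B step (if init.1.2 || decide (B < μ init) then ((init.1.1, true), init.2)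
        else step a init) l := rfl

/-- Once the flag is up it stays up (whatever the step). [folklore] -/
theorem foldCap_flag (init : TS × γ) (h : init.1.2 = true) (l : List α) :
    (foldCap μ B step init l).1.2 = true := by
  induction l generalizing init with
  | nil => exact h
  | cons a l ih =>
    rw [foldCap_cons, h, Bool.true_or, if_pos rfl]
    exact ih _ rfl

/-- **Reading a successful round backwards**: if the flag is down after folding `a :: l`, then it
was down before, the guard was silent, and the fold continued from `step a init`. [folklore] -/
theorem foldCap_cons_of_flag {init : TS × γ} {a : α} {l : List α}
    (h : (foldCap μ B step init (a :: l)).1.2 = false) :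
    init.1.2 = false ∧ μ init ≤ B ∧ foldCap μ B step init (a :: l) = foldCap μ B step (step a init) l := by
  rw [foldCap_cons] at h ⊢
  by_cases hg : (init.1.2 || decide (B < μ init)) = true
  · rw [if_pos hg, foldCap_flag μ B step _ rfl] at h
    exact absurd h (by decide)
  · simp only [Bool.or_eq_true, decide_eq_true_eq, not_or, not_lt, Bool.not_eq_true] at hg
    rw [if_neg (by simp [hg.1, Nat.not_lt.mpr hg.2])]
    exact ⟨hg.1, hg.2, rfl⟩

end FoldCap

/-! ### Contexts, environments, coded states -/

/-- The static data of one simulation step: the budget `B`, the number `n` of atoms, the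
row-major adjacency bits of the input graph, and the coded dynamic state `srep` (association
list of the non-`∅` locations). [folklore] -/
structure Ctx where
  /-- the budget bounding the code length of every loop accumulator -/
  B : ℕ
  /-- the number of atoms (vertices) -/
  n : ℕ
  /-- adjacency bits, bit `j + n * i` for the pair `(i, j)` -/
  adj : List Bool
  /-- the coded dynamic state -/
  srep : List CUpdate

/-- Lookup in an environment (association list, first match; default `dflt`). [folklore] -/
def lookupEnv (dflt : ℕ) (ρ : List (ℕ × ℕ)) (v : ℕ) : ℕ :=
  match ρ.find? fun p => p.1 == v with
  | some p => p.2
  | none => dflt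

/-- Lookup of a location in a coded state (first match; default `dflt`, the index of `∅`).
[folklore] -/
def lookupS (dflt : ℕ) (srep : List CUpdate) (f : ℕ) (idxs : List ℕ) : ℕ :=
  match srep.find? fun e => e.1 == (f, idxs) with
  | some e => e.2
  | none => dflt

/-- Lookup at the head variable. [folklore] -/
@[simp] theorem lookupEnv_cons_self (dflt : ℕ) (ρ : List (ℕ × ℕ)) (v k : ℕ) :
    lookupEnv dflt ((v, k) :: ρ) v = k := by
  simp [lookupEnv]

/-- Lookup past a different head variable. [folklore] -/
theorem lookupEnv_cons_of_ne (dflt : ℕ) (ρ : List (ℕ × ℕ)) {v w : ℕ} (h : w ≠ v) (k : ℕ) :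
    lookupEnv dflt ((v, k) :: ρ) w = lookupEnv dflt ρ w := by
  simp [lookupEnv, beq_eq_false_iff_ne.mpr h.symm]

/-- The value of a lookup is the default or a stored index. [folklore] -/
theorem lookupEnv_mem (dflt : ℕ) (ρ : List (ℕ × ℕ)) (v : ℕ) :
    lookupEnv dflt ρ v = dflt ∨ ∃ p ∈ ρ, p.2 = lookupEnv dflt ρ v := by
  unfold lookupEnv
  split
  · rename_i p hp
    exact Or.inr ⟨p, List.mem_of_find?_eq_some hp, rfl⟩
  · exact Or.inl rfl

/-- The environment denoted by an association list over the table `T` (unbound variables denote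
the object at `dflt`, i.e. `∅` for `dflt = n`). [folklore] -/
def envOf (n : ℕ) (T : List (List ℕ)) (ρ : List (ℕ × ℕ)) : Env n :=
  fun v => val n T (lookupEnv n ρ v)

/-- Binding a variable is updating the denoted environment. [folklore] -/
theorem envOf_cons (n : ℕ) (T : List (List ℕ)) (ρ : List (ℕ × ℕ)) (v k : ℕ) :
    envOf n T ((v, k) :: ρ) = Function.update (envOf n T ρ) v (val n T k) := by
  funext w
  by_cases h : w = v
  · subst h
    simp [envOf]
  · rw [Function.update_of_ne h, envOf, envOf, lookupEnv_cons_of_ne _ _ h]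

/-- The empty environment denotes the constant-`∅` environment (in a canonical table). [folklore] -/
theorem envOf_nil {T : List (List ℕ)} (hT : Canon n T) : envOf n T [] = fun _ => ∅ := by
  funext v
  simp [envOf, lookupEnv, hT.val_n]

/-- An environment is VALID for `T` if it stores valid indices. [folklore] -/
def EnvValid (T : List (List ℕ)) (ρ : List (ℕ × ℕ)) : Prop := ∀ p ∈ ρ, p.2 < T.length

/-- Valid environments look up valid indices (in a canonical table, where `n` is valid).
[folklore] -/
theorem EnvValid.lookup_lt {T : List (List ℕ)} {ρ : List (ℕ × ℕ)} (hρ : EnvValid T ρ) (hT : Canon n T) (v : ℕ) :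
    lookupEnv n ρ v < T.length := by
  rcases lookupEnv_mem n ρ v with h | ⟨p, hp, hpv⟩
  · rw [h]; have := hT.le_length; omega
  · rw [← hpv]; exact hρ p hp

/-- Binding a valid index keeps the environment valid. [folklore] -/
theorem EnvValid.cons {T : List (List ℕ)} {ρ : List (ℕ × ℕ)} (hρ : EnvValid T ρ) {v k : ℕ} (hk : k < T.length) :
    EnvValid T ((v, k) :: ρ) := by
  intro p hp
  rcases List.mem_cons.mp hp with rfl | hp
  · exact hk
  · exact hρ p hp

/-- Validity is monotone in the table. [folklore] -/
theorem EnvValid.mono {T T' : List (List ℕ)} {ρ : List (ℕ × ℕ)} (hρ : EnvValid T ρ) (h : T.length ≤ T'.length) :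
    EnvValid T' ρ := fun p hp => (hρ p hp).trans_le h

/-- **The coded state represents the dynamic state `Sd`** over the table `T`: every entry is a
valid, correctly valued, non-`∅` location, and every non-`∅` location has an entry.
[Blass–Gurevich–Shelah 1999, §4.6 (states as finite sets of non-trivial locations)] [folklore] -/
structure SRel (n : ℕ) (T : List (List ℕ)) (srep : List CUpdate) (Sd : DynState n) : Prop where
  /-- value indices are valid -/
  val_lt : ∀ e ∈ srep, e.2 < T.length
  /-- argument indices are valid -/
  args_lt : ∀ e ∈ srep, ∀ k ∈ e.1.2, k < T.length
  /-- no entry stores `∅` -/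
  val_ne : ∀ e ∈ srep, e.2 ≠ n
  /-- entries are correctly valued -/
  apply_eq : ∀ e ∈ srep, Sd e.1.1 (e.1.2.map (val n T)) = val n T e.2
  /-- every non-`∅` location is stored -/
  complete : ∀ f args, Sd f args ≠ ∅ → ∃ e ∈ srep, e.1.1 = f ∧ e.1.2.map (val n T) = args

/-! ### Table extensions -/

/-- `T'` EXTENDS `T`: `T` is a prefix and `T'` is canonical (so all old indices keep their
values). [folklore] -/
structure Extends (n : ℕ) (T T' : List (List ℕ)) : Prop where
  /-- old entries are kept -/
  isPrefix : T <+: T'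
  /-- the new table is canonical -/
  canon : Canon n T'

namespace Extends

variable {T T' T'' : List (List ℕ)}

/-- Reflexivity (for a canonical table). [folklore] -/
theorem refl (hT : Canon n T) : Extends n T T := ⟨List.prefix_rfl, hT⟩

/-- Transitivity. [folklore] -/
theorem trans (h : Extends n T T') (h' : Extends n T' T'') : Extends n T T'' :=
  ⟨h.isPrefix.trans h'.isPrefix, h'.canon⟩

/-- The table does not shrink. [folklore] -/
theorem length_le (h : Extends n T T') : T.length ≤ T'.length := h.isPrefix.length_le

/-- Old entries are unchanged. [folklore] -/
theorem getD_eq (h : Extends n T T') {i : ℕ} (hi : i < T.length) : T'.getD i [] = T.getD i [] := by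
  obtain ⟨t, rfl⟩ := h.isPrefix
  exact List.getD_append _ _ _ _ hi

/-- **Old indices keep their values.** [folklore] -/
theorem val_eq (h : Extends n T T') {i : ℕ} (hi : i < T.length) : val n T' i = val n T i :=
  (val_of_agree (m := T.length) (fun _ hj => (h.getD_eq hj).symm) hi).symm

/-- Old indices keep their `elems`. [folklore] -/
theorem elems_eq (h : Extends n T T') {i : ℕ} (hi : i < T.length) : elems n T' i = elems n T i := by
  simp only [elems, h.getD_eq hi]

/-- Mapping old indices. [folklore] -/
theorem map_val_eq (h : Extends n T T') {l : List ℕ} (hl : ∀ k ∈ l, k < T.length) :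
    l.map (val n T') = l.map (val n T) :=
  List.map_congr_left fun k hk => h.val_eq (hl k hk)

/-- Denoted environments are unchanged. [folklore] -/
theorem envOf_eq (h : Extends n T T') {ρ : List (ℕ × ℕ)} (hρ : EnvValid T ρ) (hT : Canon n T) :
    envOf n T' ρ = envOf n T ρ :=
  funext fun v => h.val_eq (hρ.lookup_lt hT v)

/-- Represented states are unchanged. [folklore] -/
theorem srel (h : Extends n T T') {srep : List CUpdate} {Sd : DynState n} (hs : SRel n T srep Sd) :
    SRel n T' srep Sd := by
  refine ⟨fun e he => (hs.val_lt e he).trans_le h.length_le,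
    fun e he k hk => (hs.args_lt e he k hk).trans_le h.length_le, hs.val_ne, fun e he => ?_,
    fun f args hf => ?_⟩
  · rw [h.map_val_eq (hs.args_lt e he), h.val_eq (hs.val_lt e he)]
    exact hs.apply_eq e he
  · obtain ⟨e, he, rfl, hargs⟩ := hs.complete f args hf
    exact ⟨e, he, rfl, by rw [h.map_val_eq (hs.args_lt e he), hargs]⟩

/-- `mkSet` extends. [folklore] -/
theorem mkSet (hT : Canon n T) {l : List ℕ} (hl : ∀ k ∈ l, k < T.length) :
    Extends n T (Sim.mkSet n T l).1 :=
  ⟨prefix_mkSet n T l, hT.canon_mkSet hl⟩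

end Extends

/-- Lists of valid indices are equal iff they denote the same list of objects. [folklore] -/
theorem Canon.map_val_inj {T : List (List ℕ)} (hT : Canon n T) {a b : List ℕ}
    (ha : ∀ k ∈ a, k < T.length) (hb : ∀ k ∈ b, k < T.length)
    (h : a.map (val n T) = b.map (val n T)) : a = b := by
  induction a generalizing b with
  | nil => simpa using h.symm
  | cons k a ih =>
    cases b with
    | nil => simp at h
    | cons k' b =>
      simp only [List.map_cons, List.cons.injEq] at h
      obtain rfl := hT.inj k k' (ha k (by simp)) (hb k' (by simp)) h.1
      rw [ih (fun x hx => ha x (by simp [hx])) (fun x hx => hb x (by simp [hx])) h.2]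

/-- **Lookup of a location is correct** in a represented state (valid argument indices).
[folklore] -/
theorem SRel.val_lookupS {T : List (List ℕ)} {srep : List CUpdate} {Sd : DynState n}
    (hs : SRel n T srep Sd) (hT : Canon n T) (f : ℕ) {idxs : List ℕ}
    (hidx : ∀ k ∈ idxs, k < T.length) :
    val n T (lookupS n srep f idxs) = Sd f (idxs.map (val n T)) ∧ lookupS n srep f idxs < T.length := by
  unfold lookupS
  split
  · rename_i e he
    have hkey : e.1 = (f, idxs) := by simpa using List.find?_some he
    have hmem := List.mem_of_find?_eq_some he
    have h1 := hs.apply_eq e hmem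
    rw [hkey] at h1
    exact ⟨h1.symm, hs.val_lt e hmem⟩
  · rename_i hnone
    refine ⟨?_, by have := hT.le_length; omega⟩
    rw [hT.val_n]
    by_contra hne
    obtain ⟨e, he, hf, hargs⟩ := hs.complete f _ (Ne.symm hne)
    have hidxs : e.1.2 = idxs := hT.map_val_inj (hs.args_lt e he) hidx hargs
    have : e.1 = (f, idxs) := Prod.ext hf hidxs
    rw [List.find?_eq_none] at hnone
    exact hnone e he (by simp [this])

/-! ### The interpreter -/

/-- `mkSet` threaded through the flag. [folklore] -/
def mk (n : ℕ) (S : TS) (l : List ℕ) : TS × ℕ :=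
  (((Sim.mkSet n S.1 l).1, S.2), (Sim.mkSet n S.1 l).2)

/-- The index of the truth value "`i` is the index of `true`". [folklore] -/
def isTrueIdx (n i : ℕ) : Bool := i == n + 1

/-- "`i` is the index of a truth value". [folklore] -/
def isBoolIdx (n i : ℕ) : Bool := i == n || i == n + 1

/-- The unique member of a one-element index list, else the index `dflt` of `∅`
(`TheUnique`). [Blass–Gurevich–Shelah 1999, §4.2] [folklore] -/
def theUniqueIdx (dflt : ℕ) : List ℕ → ℕ
  | [k] => k
  | _ => dflt

/-- The input predicate on indices: both are atoms and the adjacency bit is set.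
[Blass–Gurevich–Shelah 1999, §4.2 (input predicates live on atoms)] [folklore] -/
def adjIdx (n : ℕ) (adj : List Bool) (i j : ℕ) : Bool :=
  decide (i < n) && decide (j < n) && TwoColouring.adj n adj i j

/-- Measure of the comprehension accumulator (table-with-flag, output indices). [folklore] -/
def μC (acc : TS × List ℕ) : ℕ := cP (cTS acc.1) (cL acc.2)

/-- Measure of the ordinal accumulator (table-with-flag, (smaller ordinals, current)). [folklore] -/
def μO (acc : TS × (List ℕ × ℕ)) : ℕ := cP (cTS acc.1) (cP (cL acc.2.1) (cN acc.2.2))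

/-- Measure of the `do forall` accumulator (table-with-flag, coded updates). [folklore] -/
def μU (acc : TS × List CUpdate) : ℕ := cP (cTS acc.1) (cUL acc.2)

/-- One round of the von Neumann ordinal loop: the next ordinal is the set of all previous ones.
[Blass–Gurevich–Shelah 2002, §2 (von Neumann ordinals)] [folklore] -/
def ordStep (n : ℕ) (acc : TS × (List ℕ × ℕ)) : TS × (List ℕ × ℕ) :=
  let r := mk n acc.1 (acc.2.1 ++ [acc.2.2])
  (r.1, (acc.2.1 ++ [acc.2.2], r.2))

/-- **The von Neumann ordinal `|l|`** (the length of the driving list, in unary), guarded.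
[Blass–Gurevich–Shelah 1999, §4.8 (`Card`)] [folklore] -/
def mkOrd (B n : ℕ) (S : TS) (l : List ℕ) : TS × ℕ :=
  let r0 := mk n S []
  let res := foldCap μO B (fun _ acc => ordStep n acc) (r0.1, ([], r0.2)) l
  (res.1, res.2.2)

mutual
/-- **The value of a term** (as an index into the returned table), threading the
table-with-flag; clause by clause the BGS semantics `Term.eval` on indices: set formers go
through `mkSet` (hash-consing), truth values are the indices `n`/`n+1`, comprehension is a
guarded fold over the member indices of the range. [Blass–Gurevich–Shelah 1999, §4.4, §4.8;
2002, §2] [folklore] -/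
def ev (C : Ctx) : Term → List (ℕ × ℕ) → TS → TS × ℕ
  | .var v, ρ, S => (S, lookupEnv C.n ρ v)
  | .empty, _, S => (S, C.n)
  | .atoms, _, S => mk C.n S (List.range C.n)
  | .sUnion t, ρ, S =>
    let r := ev C t ρ S
    mk C.n r.1 (((elems C.n r.1.1 r.2).map (elems C.n r.1.1)).flatten)
  | .theUnique t, ρ, S =>
    let r := ev C t ρ S
    (r.1, theUniqueIdx C.n (elems C.n r.1.1 r.2))
  | .pair s t, ρ, S =>
    let r₁ := ev C s ρ S
    let r₂ := ev C t ρ r₁.1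
    mk C.n r₂.1 [r₁.2, r₂.2]
  | .card t, ρ, S =>
    let r := ev C t ρ S
    mkOrd C.B C.n r.1 (elems C.n r.1.1 r.2)
  | .mem s t, ρ, S =>
    let r₁ := ev C s ρ S
    let r₂ := ev C t ρ r₁.1
    (r₂.1, boolIdx C.n (decide (r₁.2 ∈ elems C.n r₂.1.1 r₂.2)))
  | .eq s t, ρ, S =>
    let r₁ := ev C s ρ S
    let r₂ := ev C t ρ r₁.1
    (r₂.1, boolIdx C.n (r₁.2 == r₂.2))
  | .cTrue, _, S => (S, C.n + 1)
  | .cFalse, _, S => (S, C.n)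
  | .not t, ρ, S =>
    let r := ev C t ρ S
    (r.1, boolIdx C.n (r.2 == C.n))
  | .and s t, ρ, S =>
    let r₁ := ev C s ρ S
    let r₂ := ev C t ρ r₁.1
    (r₂.1, boolIdx C.n (isTrueIdx C.n r₁.2 && isTrueIdx C.n r₂.2))
  | .or s t, ρ, S =>
    let r₁ := ev C s ρ S
    let r₂ := ev C t ρ r₁.1
    (r₂.1, boolIdx C.n (isBoolIdx C.n r₁.2 && isBoolIdx C.n r₂.2 &&
      (isTrueIdx C.n r₁.2 || isTrueIdx C.n r₂.2)))
  | .edge s t, ρ, S =>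
    let r₁ := ev C s ρ S
    let r₂ := ev C t ρ r₁.1
    (r₂.1, boolIdx C.n (adjIdx C.n C.adj r₁.2 r₂.2))
  | .dyn f args, ρ, S =>
    let r := evArgs C args ρ S
    (r.1, lookupS C.n C.srep f r.2)
  | .compr v t r g, ρ, S =>
    let rr := ev C r ρ S
    let res := foldCap μC C.B (fun a acc =>
        let rg := ev C g ((v, a) :: ρ) acc.1
        if isTrueIdx C.n rg.2 then
          let rt := ev C t ((v, a) :: ρ) rg.1
          (rt.1, acc.2 ++ [rt.2])
        else (rg.1, acc.2)) (rr.1, []) (elems C.n rr.1.1 rr.2)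
    mk C.n res.1 res.2
/-- The values of an argument list, threading the table-with-flag. [folklore] -/
def evArgs (C : Ctx) : Args → List (ℕ × ℕ) → TS → TS × List ℕ
  | .nil, _, S => (S, [])
  | .cons t rest, ρ, S =>
    let r := ev C t ρ S
    let rs := evArgs C rest ρ r.1
    (rs.1, r.2 :: rs.2)
end

/-- The round of the comprehension loop at the member index `a`: evaluate the guard with
`v ↦ a`, and if it holds append the value of the head term. [Blass–Gurevich–Shelah 1999, §4.4]
[folklore] -/
def comprStep (C : Ctx) (v : ℕ) (t g : Term) (ρ : List (ℕ × ℕ)) (a : ℕ) (acc : TS × List ℕ) :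
    TS × List ℕ :=
  let rg := ev C g ((v, a) :: ρ) acc.1
  if isTrueIdx C.n rg.2 then
    let rt := ev C t ((v, a) :: ρ) rg.1
    (rt.1, acc.2 ++ [rt.2])
  else (rg.1, acc.2)

/-- The comprehension round when the guard holds. [folklore] -/
theorem comprStep_of_pos (C : Ctx) (v : ℕ) (t g : Term) (ρ : List (ℕ × ℕ)) (a : ℕ) (acc : TS × List ℕ)
    (h : isTrueIdx C.n (ev C g ((v, a) :: ρ) acc.1).2 = true) :
    comprStep C v t g ρ a acc =
      ((ev C t ((v, a) :: ρ) (ev C g ((v, a) :: ρ) acc.1).1).1,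
        acc.2 ++ [(ev C t ((v, a) :: ρ) (ev C g ((v, a) :: ρ) acc.1).1).2]) := by
  unfold comprStep
  rw [if_pos h]

/-- The comprehension round when the guard fails. [folklore] -/
theorem comprStep_of_neg (C : Ctx) (v : ℕ) (t g : Term) (ρ : List (ℕ × ℕ)) (a : ℕ) (acc : TS × List ℕ)
    (h : ¬ isTrueIdx C.n (ev C g ((v, a) :: ρ) acc.1).2 = true) :
    comprStep C v t g ρ a acc = ((ev C g ((v, a) :: ρ) acc.1).1, acc.2) := by
  unfold comprStep
  rw [if_neg h]

/-- Unfolding `ev` at a comprehension term. [folklore] -/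
theorem ev_compr (C : Ctx) (v : ℕ) (t r g : Term) (ρ : List (ℕ × ℕ)) (S : TS) :
    ev C (.compr v t r g) ρ S =
      mk C.n (foldCap μC C.B (comprStep C v t g ρ) ((ev C r ρ S).1, [])
        (elems C.n (ev C r ρ S).1.1 (ev C r ρ S).2)).1
      (foldCap μC C.B (comprStep C v t g ρ) ((ev C r ρ S).1, [])
        (elems C.n (ev C r ρ S).1.1 (ev C r ρ S).2)).2 := by
  rfl

/-- **The coded update set of a rule** (`Rule.den` on indices), threading the table-with-flag;
`do forall` is a guarded fold concatenating the update lists of the rounds.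
[Blass–Gurevich–Shelah 1999, §4.5–4.6] [folklore] -/
def den (C : Ctx) : Rule → List (ℕ × ℕ) → TS → TS × List CUpdate
  | .skip, _, S => (S, [])
  | .update f args t, ρ, S =>
    let ra := evArgs C args ρ S
    let rt := ev C t ρ ra.1
    (rt.1, [((f, ra.2), rt.2)])
  | .cond g R₁ R₂, ρ, S =>
    let rg := ev C g ρ S
    if isTrueIdx C.n rg.2 then den C R₁ ρ rg.1 else den C R₂ ρ rg.1
  | .forallDo v r R, ρ, S =>
    let rr := ev C r ρ S
    foldCap μU C.B (fun a acc =>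
      let rd := den C R ((v, a) :: ρ) acc.1
      (rd.1, acc.2 ++ rd.2)) (rr.1, []) (elems C.n rr.1.1 rr.2)

/-- The round of the `do forall` loop at the member index `a`. [folklore] -/
def forallStep (C : Ctx) (v : ℕ) (R : Rule) (ρ : List (ℕ × ℕ)) (a : ℕ) (acc : TS × List CUpdate) :
    TS × List CUpdate :=
  let rd := den C R ((v, a) :: ρ) acc.1
  (rd.1, acc.2 ++ rd.2)

/-- Unfolding `den` at a `do forall` rule. [folklore] -/
theorem den_forallDo (C : Ctx) (v : ℕ) (r : Term) (R : Rule) (ρ : List (ℕ × ℕ)) (S : TS) :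
    den C (.forallDo v r R) ρ S =
      foldCap μU C.B (forallStep C v R ρ) ((ev C r ρ S).1, [])
        (elems C.n (ev C r ρ S).1.1 (ev C r ρ S).2) := rfl

/-- CONSISTENCY of a coded update set: no two updates clash. [Blass–Gurevich–Shelah 1999, §4.6]
[folklore] -/
def consistentB (ups : List CUpdate) : Bool :=
  ups.all fun u => ups.all fun u' => !(u.1 == u'.1) || (u.2 == u'.2)

/-- **Firing a coded update set** on a coded state: if consistent, the updates with non-`∅`
content followed by the untouched old entries; otherwise nothing changes.
[Blass–Gurevich–Shelah 1999, §4.6] [folklore] -/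
def fireS (n : ℕ) (srep ups : List CUpdate) : List CUpdate :=
  if consistentB ups then
    (ups.filter fun u => !(u.2 == n)) ++ (srep.filter fun e => !(ups.any fun u => u.1 == e.1))
  else srep

/-! ### Overflow flags are sticky -/

/-- `mk` passes the flag through. [folklore] -/
@[simp] theorem mk_flag (n : ℕ) (S : TS) (l : List ℕ) : (mk n S l).1.2 = S.2 := rfl

/-- The table returned by `mk`. [folklore] -/
@[simp] theorem mk_fst_fst (n : ℕ) (S : TS) (l : List ℕ) : (mk n S l).1.1 = (Sim.mkSet n S.1 l).1 :=
  rfl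

/-- The index returned by `mk`. [folklore] -/
@[simp] theorem mk_snd (n : ℕ) (S : TS) (l : List ℕ) : (mk n S l).2 = (Sim.mkSet n S.1 l).2 := rfl

/-- `mkOrd` keeps a raised flag raised. [folklore] -/
theorem mkOrd_flag (B n : ℕ) {S : TS} (h : S.2 = true) (l : List ℕ) : (mkOrd B n S l).1.2 = true := by
  unfold mkOrd
  exact foldCap_flag _ _ _ _ h l

section Flags

variable (C : Ctx)

mutual
/-- **The overflow flag is sticky through `ev`.** [folklore] -/
theorem ev_flag : ∀ (t : Term) (ρ : List (ℕ × ℕ)) (S : TS), S.2 = true → (ev C t ρ S).1.2 = true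
  | .var _, _, _, h => by simpa only [ev] using h
  | .empty, _, _, h => by simpa only [ev] using h
  | .atoms, _, _, h => by simpa only [ev, mk_flag] using h
  | .sUnion t, ρ, S, h => by simpa only [ev, mk_flag] using ev_flag t ρ S h
  | .theUnique t, ρ, S, h => by simpa only [ev] using ev_flag t ρ S h
  | .pair s t, ρ, S, h => by simpa only [ev, mk_flag] using ev_flag t ρ _ (ev_flag s ρ S h)
  | .card t, ρ, S, h => by simpa only [ev] using mkOrd_flag C.B C.n (ev_flag t ρ S h) _
  | .mem s t, ρ, S, h => by simpa only [ev] using ev_flag t ρ _ (ev_flag s ρ S h)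
  | .eq s t, ρ, S, h => by simpa only [ev] using ev_flag t ρ _ (ev_flag s ρ S h)
  | .cTrue, _, _, h => by simpa only [ev] using h
  | .cFalse, _, _, h => by simpa only [ev] using h
  | .not t, ρ, S, h => by simpa only [ev] using ev_flag t ρ S h
  | .and s t, ρ, S, h => by simpa only [ev] using ev_flag t ρ _ (ev_flag s ρ S h)
  | .or s t, ρ, S, h => by simpa only [ev] using ev_flag t ρ _ (ev_flag s ρ S h)
  | .edge s t, ρ, S, h => by simpa only [ev] using ev_flag t ρ _ (ev_flag s ρ S h)
  | .dyn _ args, ρ, S, h => by simpa only [ev] using evArgs_flag args ρ S h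
  | .compr v t r g, ρ, S, h => by
    rw [ev_compr, mk_flag]
    exact foldCap_flag μC C.B (comprStep C v t g ρ) ((ev C r ρ S).1, []) (ev_flag r ρ S h) _
/-- The overflow flag is sticky through `evArgs`. [folklore] -/
theorem evArgs_flag : ∀ (a : Args) (ρ : List (ℕ × ℕ)) (S : TS), S.2 = true → (evArgs C a ρ S).1.2 = true
  | .nil, _, _, h => by simpa only [evArgs] using h
  | .cons t rest, ρ, S, h => by simpa only [evArgs] using evArgs_flag rest ρ _ (ev_flag t ρ S h)
end

/-- The overflow flag is sticky through `den`. [folklore] -/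
theorem den_flag : ∀ (R : Rule) (ρ : List (ℕ × ℕ)) (S : TS), S.2 = true → (den C R ρ S).1.2 = true
  | .skip, _, _, h => by simpa only [den] using h
  | .update f args t, ρ, S, h => by
    simpa only [den] using ev_flag C t ρ _ (evArgs_flag C args ρ S h)
  | .cond g R₁ R₂, ρ, S, h => by
    simp only [den]
    split
    · exact den_flag R₁ ρ _ (ev_flag C g ρ S h)
    · exact den_flag R₂ ρ _ (ev_flag C g ρ S h)
  | .forallDo v r R, ρ, S, h => by
    rw [den_forallDo]
    exact foldCap_flag μU C.B (forallStep C v R ρ) ((ev C r ρ S).1, []) (ev_flag C r ρ S h) _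

/-- Contrapositive reading: a lowered flag after `ev` was lowered before. [folklore] -/
theorem flag_of_ev {t : Term} {ρ : List (ℕ × ℕ)} {S : TS} (h : (ev C t ρ S).1.2 = false) :
    S.2 = false := by
  by_contra h'
  rw [Bool.not_eq_false] at h'
  have := ev_flag C t ρ S h'
  rw [h] at this
  exact Bool.false_ne_true this

/-- Contrapositive reading for `evArgs`. [folklore] -/
theorem flag_of_evArgs {a : Args} {ρ : List (ℕ × ℕ)} {S : TS} (h : (evArgs C a ρ S).1.2 = false) :
    S.2 = false := by
  by_contra h'
  rw [Bool.not_eq_false] at h'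
  have := evArgs_flag C a ρ S h'
  rw [h] at this
  exact Bool.false_ne_true this

/-- Contrapositive reading for `den`. [folklore] -/
theorem flag_of_den {R : Rule} {ρ : List (ℕ × ℕ)} {S : TS} (h : (den C R ρ S).1.2 = false) :
    S.2 = false := by
  by_contra h'
  rw [Bool.not_eq_false] at h'
  have := den_flag C R ρ S h'
  rw [h] at this
  exact Bool.false_ne_true this

/-- Contrapositive reading for a guarded fold. [folklore] -/
theorem flag_of_foldCap {α γ : Type} (μ : TS × γ → ℕ) (B : ℕ) (step : α → TS × γ → TS × γ)
    {init : TS × γ} {l : List α} (h : (foldCap μ B step init l).1.2 = false) : init.1.2 = false := by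
  by_contra h'
  rw [Bool.not_eq_false] at h'
  have := foldCap_flag μ B step init h' l
  rw [h] at this
  exact Bool.false_ne_true this

end Flags

/-! ### Soundness of the evaluator -/

/-- The input graph read off a context (adjacency bits, symmetrised, loops removed — the graph
`encodingGraph` decodes). [folklore] -/
abbrev Ctx.G (C : Ctx) : SimpleGraph (Fin C.n) := TwoColouring.graph C.n C.adj

/-- The simulation invariant of a table during one step: canonical, and the context's coded
state represents the dynamic state `Sd`. [folklore] -/
structure TInv (C : Ctx) (Sd : DynState C.n) (T : List (List ℕ)) : Prop where
  /-- the table is canonical -/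
  canon : Canon C.n T
  /-- the coded state represents `Sd` -/
  srel : SRel C.n T C.srep Sd

/-- The invariant survives table extensions. [folklore] -/
theorem TInv.of_extends {C : Ctx} {Sd : DynState C.n} {T T' : List (List ℕ)} (h : TInv C Sd T)
    (hx : Extends C.n T T') : TInv C Sd T' :=
  ⟨hx.canon, hx.srel h.srel⟩

section Sound

variable (C : Ctx) (Sd : DynState C.n)

/-- **Soundness of `ev` at the term `t`**: from any valid environment and table satisfying the
invariant, if the flag is down afterwards then the table was extended canonically and the
returned index denotes `Term.eval`. [folklore] -/
def SoundT (t : Term) : Prop :=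
  ∀ (ρ : List (ℕ × ℕ)) (S : TS), (ev C t ρ S).1.2 = false → TInv C Sd S.1 → EnvValid S.1 ρ →
    Extends C.n S.1 (ev C t ρ S).1.1 ∧ (ev C t ρ S).2 < (ev C t ρ S).1.1.length ∧
      val C.n (ev C t ρ S).1.1 (ev C t ρ S).2 = t.eval C.G Sd (envOf C.n S.1 ρ)

/-- Soundness of `evArgs` at the argument list `a`. [folklore] -/
def SoundA (a : Args) : Prop :=
  ∀ (ρ : List (ℕ × ℕ)) (S : TS), (evArgs C a ρ S).1.2 = false → TInv C Sd S.1 → EnvValid S.1 ρ →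
    Extends C.n S.1 (evArgs C a ρ S).1.1 ∧ (∀ k ∈ (evArgs C a ρ S).2, k < (evArgs C a ρ S).1.1.length) ∧
      (evArgs C a ρ S).2.map (val C.n (evArgs C a ρ S).1.1) = a.eval C.G Sd (envOf C.n S.1 ρ)

variable {C Sd}

/-- Sequential evaluation of two terms (the shape of every binary clause). [folklore] -/
theorem seq_sound {s t : Term} (hs : SoundT C Sd s) (ht : SoundT C Sd t) {ρ : List (ℕ × ℕ)}
    {S : TS} (h : (ev C t ρ (ev C s ρ S).1).1.2 = false) (hI : TInv C Sd S.1) (hρ : EnvValid S.1 ρ) :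
    Extends C.n S.1 (ev C t ρ (ev C s ρ S).1).1.1 ∧
    (ev C s ρ S).2 < (ev C t ρ (ev C s ρ S).1).1.1.length ∧
    (ev C t ρ (ev C s ρ S).1).2 < (ev C t ρ (ev C s ρ S).1).1.1.length ∧
    val C.n (ev C t ρ (ev C s ρ S).1).1.1 (ev C s ρ S).2 = s.eval C.G Sd (envOf C.n S.1 ρ) ∧
    val C.n (ev C t ρ (ev C s ρ S).1).1.1 (ev C t ρ (ev C s ρ S).1).2 =
      t.eval C.G Sd (envOf C.n S.1 ρ) := by
  have h1 : (ev C s ρ S).1.2 = false := flag_of_ev C h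
  obtain ⟨hx1, hi1, hv1⟩ := hs ρ S h1 hI hρ
  obtain ⟨hx2, hi2, hv2⟩ := ht ρ _ h (hI.of_extends hx1) (hρ.mono hx1.length_le)
  refine ⟨hx1.trans hx2, hi1.trans_le hx2.length_le, hi2, ?_, ?_⟩
  · rw [hx2.val_eq hi1, hv1]
  · rw [hv2, hx1.envOf_eq hρ hI.canon]

/-- A clause returning a truth-value index after two evaluations. [folklore] -/
theorem seq_bool_sound {s t : Term} (hs : SoundT C Sd s) (ht : SoundT C Sd t)
    (f : ℕ → List (List ℕ) → ℕ → ℕ → Bool) (F : SimpleGraph (Fin C.n) → Obj C.n → Obj C.n → Obj C.n)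
    (hfF : ∀ (T : List (List ℕ)) (i j : ℕ), Canon C.n T → i < T.length → j < T.length →
      HF.ofBool (f C.n T i j) = F C.G (val C.n T i) (val C.n T j))
    {ρ : List (ℕ × ℕ)} {S : TS} (h : (ev C t ρ (ev C s ρ S).1).1.2 = false) (hI : TInv C Sd S.1)
    (hρ : EnvValid S.1 ρ) :
    Extends C.n S.1 (ev C t ρ (ev C s ρ S).1).1.1 ∧
    boolIdx C.n (f C.n (ev C t ρ (ev C s ρ S).1).1.1 (ev C s ρ S).2 (ev C t ρ (ev C s ρ S).1).2) <
      (ev C t ρ (ev C s ρ S).1).1.1.length ∧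
    val C.n (ev C t ρ (ev C s ρ S).1).1.1
      (boolIdx C.n (f C.n (ev C t ρ (ev C s ρ S).1).1.1 (ev C s ρ S).2 (ev C t ρ (ev C s ρ S).1).2)) =
      F C.G (s.eval C.G Sd (envOf C.n S.1 ρ)) (t.eval C.G Sd (envOf C.n S.1 ρ)) := by
  obtain ⟨hx, hi, hj, hvs, hvt⟩ := seq_sound hs ht h hI hρ
  refine ⟨hx, hx.canon.boolIdx_lt_length _, ?_⟩
  rw [hx.canon.val_boolIdx, hfF _ _ _ hx.canon hi hj, hvs, hvt]

/-- Soundness at a variable. [folklore] -/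
theorem soundT_var (v : ℕ) : SoundT C Sd (.var v) := by
  intro ρ S _ hI hρ
  simp only [ev]
  exact ⟨Extends.refl hI.canon, hρ.lookup_lt hI.canon v, rfl⟩

/-- Soundness at `∅`. [folklore] -/
theorem soundT_empty : SoundT C Sd .empty := by
  intro ρ S _ hI _
  simp only [ev]
  exact ⟨Extends.refl hI.canon, by have := hI.canon.le_length; omega, by
    rw [hI.canon.val_n]; rfl⟩

/-- Soundness at `true`. [folklore] -/
theorem soundT_cTrue : SoundT C Sd .cTrue := by
  intro ρ S _ hI _
  simp only [ev]
  exact ⟨Extends.refl hI.canon, by have := hI.canon.le_length; omega, by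
    rw [hI.canon.val_n_succ]; rfl⟩

/-- Soundness at `false`. [folklore] -/
theorem soundT_cFalse : SoundT C Sd .cFalse := by
  intro ρ S _ hI _
  simp only [ev]
  exact ⟨Extends.refl hI.canon, by have := hI.canon.le_length; omega, by
    rw [hI.canon.val_n]; rfl⟩

/-- Soundness at `Atoms`. [folklore] -/
theorem soundT_atoms : SoundT C Sd .atoms := by
  intro ρ S _ hI _
  simp only [ev, mk_fst_fst, mk_snd]
  have hl : ∀ k ∈ List.range C.n, k < S.1.length := fun k hk => by
    have := hI.canon.le_length; have := List.mem_range.mp hk; omega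
  refine ⟨Extends.mkSet hI.canon hl, snd_mkSet_lt _ _ _, ?_⟩
  rw [hI.canon.val_mkSet hl]
  refine HF.ext (HF.not_isAtom_ofList _) (HF.not_isAtom_ofFinset _) fun x => ?_
  rw [HF.mem_ofList, List.mem_map]
  show _ ↔ x ∈ (HF.atoms : Obj C.n)
  rw [HF.mem_atoms]
  constructor
  · rintro ⟨k, hk, rfl⟩
    exact (isAtom_val_iff _ k).mpr (List.mem_range.mp hk)
  · rintro ⟨a, rfl⟩
    exact ⟨a, List.mem_range.mpr a.2, val_of_lt _ a.2⟩

/-- Soundness at `⋃ t`. [folklore] -/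
theorem soundT_sUnion {t : Term} (ht : SoundT C Sd t) : SoundT C Sd (.sUnion t) := by
  intro ρ S h hI hρ
  simp only [ev, mk_fst_fst, mk_snd, mk_flag] at h ⊢
  obtain ⟨hx, hi, hv⟩ := ht ρ S h hI hρ
  set T₁ := (ev C t ρ S).1.1
  set i := (ev C t ρ S).2
  set L := ((elems C.n T₁ i).map (elems C.n T₁)).flatten
  have hL : ∀ k ∈ L, k < T₁.length := by
    intro k hk
    obtain ⟨e, he, hk⟩ := List.mem_flatten.mp hk
    obtain ⟨k₀, hk₀, rfl⟩ := List.mem_map.mp he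
    have h0 := (hx.canon.lt_of_mem_elems hi hk₀).trans hi
    exact (hx.canon.lt_of_mem_elems h0 hk).trans h0
  refine ⟨hx.trans (Extends.mkSet hx.canon hL), snd_mkSet_lt _ _ _, ?_⟩
  rw [hx.canon.val_mkSet hL]
  show _ = HF.sUnion (t.eval C.G Sd (envOf C.n S.1 ρ))
  rw [← hv]
  refine HF.ext (HF.not_isAtom_ofList _) (HF.not_isAtom_sUnion _) fun x => ?_
  rw [HF.mem_ofList, List.mem_map, HF.mem_sUnion]
  constructor
  · rintro ⟨k, hk, rfl⟩
    obtain ⟨e, he, hk⟩ := List.mem_flatten.mp hk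
    obtain ⟨k₀, hk₀, rfl⟩ := List.mem_map.mp he
    have h0 := (hx.canon.lt_of_mem_elems hi hk₀).trans hi
    exact ⟨val C.n T₁ k₀, (hx.canon.mem_val_iff_elems hi _).mpr ⟨k₀, hk₀, rfl⟩,
      (hx.canon.mem_val_iff_elems h0 _).mpr ⟨k, hk, rfl⟩⟩
  · rintro ⟨y, hy, hxy⟩
    obtain ⟨k₀, hk₀, rfl⟩ := (hx.canon.mem_val_iff_elems hi y).mp hy
    have h0 := (hx.canon.lt_of_mem_elems hi hk₀).trans hi
    obtain ⟨k, hk, rfl⟩ := (hx.canon.mem_val_iff_elems h0 x).mp hxy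
    exact ⟨k, List.mem_flatten.mpr ⟨_, List.mem_map.mpr ⟨k₀, hk₀, rfl⟩, hk⟩, rfl⟩

/-- `theUniqueIdx` of a list that is not a singleton is the default. [folklore] -/
theorem theUniqueIdx_of_length_ne {dflt : ℕ} {l : List ℕ} (h : l.length ≠ 1) :
    theUniqueIdx dflt l = dflt := by
  match l, h with
  | [], _ => rfl
  | [_], h => exact absurd rfl h
  | _ :: _ :: _, _ => rfl

/-- Soundness at `TheUnique t`. [folklore] -/
theorem soundT_theUnique {t : Term} (ht : SoundT C Sd t) : SoundT C Sd (.theUnique t) := by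
  intro ρ S h hI hρ
  simp only [ev] at h ⊢
  obtain ⟨hx, hi, hv⟩ := ht ρ S h hI hρ
  set T₁ := (ev C t ρ S).1.1
  set i := (ev C t ρ S).2
  refine ⟨hx, ?_, ?_⟩
  · by_cases h1 : (elems C.n T₁ i).length = 1
    · obtain ⟨k, hk⟩ := List.length_eq_one_iff.mp h1
      rw [hk]
      show k < T₁.length
      exact (hx.canon.lt_of_mem_elems hi (by rw [hk]; simp)).trans hi
    · rw [theUniqueIdx_of_length_ne h1]
      have := hx.canon.le_length; omega
  · show _ = HF.theUnique (t.eval C.G Sd (envOf C.n S.1 ρ))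
    rw [← hv]
    by_cases h1 : (elems C.n T₁ i).length = 1
    · obtain ⟨k, hk⟩ := List.length_eq_one_iff.mp h1
      rw [hk]
      show val C.n T₁ k = _
      symm
      apply HF.theUnique_eq_of_members_eq
      ext x
      rw [HF.mem_members, hx.canon.mem_val_iff_elems hi, hk, Finset.mem_singleton]
      simp only [List.mem_singleton, exists_eq_left]
      exact eq_comm
    · rw [theUniqueIdx_of_length_ne h1, hx.canon.val_n]
      symm
      apply HF.theUnique_eq_empty
      intro x hx'
      have := hx.canon.card_members_val hi
      rw [hx', Finset.card_singleton] at this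
      exact h1 this.symm

/-- Soundness at `Pair(s, t)`. [folklore] -/
theorem soundT_pair {s t : Term} (hs : SoundT C Sd s) (ht : SoundT C Sd t) : SoundT C Sd (.pair s t) := by
  intro ρ S h hI hρ
  simp only [ev, mk_fst_fst, mk_snd, mk_flag] at h ⊢
  obtain ⟨hx, hi, hj, hvs, hvt⟩ := seq_sound hs ht h hI hρ
  set T₂ := (ev C t ρ (ev C s ρ S).1).1.1
  have hl : ∀ k ∈ [(ev C s ρ S).2, (ev C t ρ (ev C s ρ S).1).2], k < T₂.length := by
    intro k hk
    simp only [List.mem_cons, List.not_mem_nil, or_false] at hk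
    rcases hk with rfl | rfl
    · exact hi
    · exact hj
  refine ⟨hx.trans (Extends.mkSet hx.canon hl), snd_mkSet_lt _ _ _, ?_⟩
  rw [hx.canon.val_mkSet hl]
  show _ = HF.pair (s.eval C.G Sd (envOf C.n S.1 ρ)) (t.eval C.G Sd (envOf C.n S.1 ρ))
  rw [← hvs, ← hvt]
  refine HF.ext (HF.not_isAtom_ofList _) (HF.not_isAtom_pair _ _) fun x => ?_
  simp only [HF.mem_ofList, List.map_cons, List.map_nil, List.mem_cons, List.not_mem_nil, or_false,
    HF.mem_pair]

/-- Soundness at `s ∈ t`. [folklore] -/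
theorem soundT_mem {s t : Term} (hs : SoundT C Sd s) (ht : SoundT C Sd t) : SoundT C Sd (.mem s t) := by
  intro ρ S h hI hρ
  simp only [ev] at h ⊢
  exact seq_bool_sound hs ht (fun n T i j => decide (i ∈ elems n T j)) (fun _ x y => memB x y)
    (fun T i j hT hi hj => by
      unfold memB
      congr 1
      exact decide_eq_decide.mpr (by rw [hT.mem_elems_iff hj]; simp [hi])) h hI hρ

/-- Soundness at `s = t`. [folklore] -/
theorem soundT_eq {s t : Term} (hs : SoundT C Sd s) (ht : SoundT C Sd t) : SoundT C Sd (.eq s t) := by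
  intro ρ S h hI hρ
  simp only [ev] at h ⊢
  exact seq_bool_sound hs ht (fun _ _ i j => i == j) (fun _ x y => eqB x y)
    (fun T i j hT hi hj => by
      unfold eqB
      congr 1
      by_cases hij : i = j
      · subst hij; simp
      · have hne : val C.n T i ≠ val C.n T j := fun h' => hij (hT.inj i j hi hj h')
        simp [hij, hne]) h hI hρ

/-- Soundness at `¬ t`. [folklore] -/
theorem soundT_not {t : Term} (ht : SoundT C Sd t) : SoundT C Sd (.not t) := by
  intro ρ S h hI hρ
  simp only [ev] at h ⊢
  obtain ⟨hx, hi, hv⟩ := ht ρ S h hI hρ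
  refine ⟨hx, hx.canon.boolIdx_lt_length _, ?_⟩
  rw [hx.canon.val_boolIdx]
  show _ = HF.bnot (t.eval C.G Sd (envOf C.n S.1 ρ))
  rw [← hv, HF.bnot]
  congr 1
  rw [Bool.eq_iff_iff, beq_iff_eq, decide_eq_true_eq, hx.canon.val_eq_ofBool_iff hi]
  rfl

/-- The truth-value tests on indices are correct. [folklore] -/
theorem isTrueIdx_iff {T : List (List ℕ)} (hT : Canon n T) {i : ℕ} (hi : i < T.length) :
    isTrueIdx n i = true ↔ val n T i = HF.ofBool true := by
  rw [isTrueIdx, beq_iff_eq, hT.val_eq_ofBool_iff hi]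
  rfl

/-- The Boolean test on indices is correct. [folklore] -/
theorem isBoolIdx_iff {T : List (List ℕ)} (hT : Canon n T) {i : ℕ} (hi : i < T.length) :
    isBoolIdx n i = true ↔ (val n T i).IsBool := by
  rw [isBoolIdx, Bool.or_eq_true, beq_iff_eq, beq_iff_eq]
  constructor
  · rintro (rfl | rfl)
    · exact ⟨false, hT.val_n⟩
    · exact ⟨true, hT.val_n_succ⟩
  · rintro ⟨b, hb⟩
    rw [hT.val_eq_ofBool_iff hi] at hb
    cases b
    · exact Or.inl hb
    · exact Or.inr hb

/-- Soundness at `s ∧ t`. [folklore] -/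
theorem soundT_and {s t : Term} (hs : SoundT C Sd s) (ht : SoundT C Sd t) : SoundT C Sd (.and s t) := by
  intro ρ S h hI hρ
  simp only [ev] at h ⊢
  exact seq_bool_sound hs ht (fun n _ i j => isTrueIdx n i && isTrueIdx n j) (fun _ x y => HF.band x y)
    (fun T i j hT hi hj => by
      unfold HF.band
      congr 1
      rw [Bool.eq_iff_iff, Bool.and_eq_true, isTrueIdx_iff hT hi, isTrueIdx_iff hT hj,
        decide_eq_true_eq]) h hI hρ

/-- Soundness at `s ∨ t`. [folklore] -/
theorem soundT_or {s t : Term} (hs : SoundT C Sd s) (ht : SoundT C Sd t) : SoundT C Sd (.or s t) := by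
  intro ρ S h hI hρ
  simp only [ev] at h ⊢
  exact seq_bool_sound hs ht
    (fun n _ i j => isBoolIdx n i && isBoolIdx n j && (isTrueIdx n i || isTrueIdx n j))
    (fun _ x y => HF.bor x y)
    (fun T i j hT hi hj => by
      classical
      unfold HF.bor
      congr 1
      rw [Bool.eq_iff_iff]
      simp only [Bool.and_eq_true, Bool.or_eq_true, isBoolIdx_iff hT hi, isBoolIdx_iff hT hj,
        isTrueIdx_iff hT hi, isTrueIdx_iff hT hj, decide_eq_true_eq, and_assoc]) h hI hρ

/-- An index denotes the atom `a` iff it is `a`. [folklore] -/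
theorem val_eq_atom_iff (T : List (List ℕ)) (i : ℕ) (a : Fin n) : val n T i = HF.atom a ↔ i = a := by
  constructor
  · intro h
    have hat : (val n T i).IsAtom := ⟨a, h⟩
    have hi := (isAtom_val_iff T i).mp hat
    rw [val_of_lt T hi] at h
    exact congrArg Fin.val (HF.atom_injective h)
  · rintro rfl
    exact val_of_lt T a.2

/-- Soundness at the input predicate `E(s, t)`. [folklore] -/
theorem soundT_edge {s t : Term} (hs : SoundT C Sd s) (ht : SoundT C Sd t) : SoundT C Sd (.edge s t) := by
  intro ρ S h hI hρ
  simp only [ev] at h ⊢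
  exact seq_bool_sound hs ht (fun n _ i j => adjIdx n C.adj i j) (fun G x y => edgeB G x y)
    (fun T i j hT hi hj => by
      classical
      unfold edgeB adjIdx
      congr 1
      rw [Bool.eq_iff_iff]
      simp only [Bool.and_eq_true, decide_eq_true_eq]
      constructor
      · rintro ⟨⟨hin, hjn⟩, hadj⟩
        exact ⟨⟨i, hin⟩, ⟨j, hjn⟩, val_of_lt T hin, val_of_lt T hjn,
          (TwoColouring.graph_adj C.n C.adj _ _).mpr hadj⟩
      · rintro ⟨a, b, ha, hb, hadj⟩
        rw [val_eq_atom_iff] at ha hb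
        subst ha; subst hb
        exact ⟨⟨a.2, b.2⟩, (TwoColouring.graph_adj C.n C.adj a b).mp hadj⟩) h hI hρ

/-- Soundness at a dynamic function symbol. [folklore] -/
theorem soundT_dyn {f : ℕ} {args : Args} (ha : SoundA C Sd args) : SoundT C Sd (.dyn f args) := by
  intro ρ S h hI hρ
  simp only [ev] at h ⊢
  obtain ⟨hx, hks, hv⟩ := ha ρ S h hI hρ
  obtain ⟨hval, hlt⟩ := (hx.srel hI.srel).val_lookupS hx.canon f hks
  refine ⟨hx, hlt, ?_⟩
  rw [hval, hv]
  rfl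

/-! #### `Card`: the guarded ordinal loop -/

/-- Invariant of the ordinal loop after `m` rounds: flag down, canonical table, `cur` denotes
the ordinal `m`, `ords` denote exactly the smaller ordinals. [folklore] -/
structure OrdInv (n : ℕ) (acc : TS × (List ℕ × ℕ)) (m : ℕ) : Prop where
  /-- the flag is down -/
  flag : acc.1.2 = false
  /-- the table is canonical -/
  canon : Canon n acc.1.1
  /-- the current ordinal index is valid -/
  cur_lt : acc.2.2 < acc.1.1.length
  /-- the earlier ordinal indices are valid -/
  ords_lt : ∀ k ∈ acc.2.1, k < acc.1.1.length
  /-- the current index denotes `m` -/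
  val_cur : val n acc.1.1 acc.2.2 = HF.ordinal m
  /-- the earlier indices denote `0, …, m - 1` -/
  val_ords : ∀ x, (∃ k ∈ acc.2.1, val n acc.1.1 k = x) ↔ ∃ j < m, x = HF.ordinal j

/-- One round of the ordinal loop keeps the invariant (and extends the table). [folklore] -/
theorem ordInv_ordStep {acc : TS × (List ℕ × ℕ)} {m : ℕ} (h : OrdInv n acc m) :
    OrdInv n (ordStep n acc) (m + 1) ∧ Extends n acc.1.1 (ordStep n acc).1.1 := by
  have hl : ∀ k ∈ acc.2.1 ++ [acc.2.2], k < acc.1.1.length := by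
    intro k hk
    rw [List.mem_append, List.mem_singleton] at hk
    rcases hk with hk | rfl
    · exact h.ords_lt k hk
    · exact h.cur_lt
  have hx : Extends n acc.1.1 (ordStep n acc).1.1 := Extends.mkSet h.canon hl
  refine ⟨⟨?_, hx.canon, ?_, ?_, ?_, ?_⟩, hx⟩
  · show acc.1.2 = false
    exact h.flag
  · exact snd_mkSet_lt _ _ _
  · intro k hk
    exact (hl k hk).trans_le hx.length_le
  · show val n (Sim.mkSet n acc.1.1 (acc.2.1 ++ [acc.2.2])).1
      (Sim.mkSet n acc.1.1 (acc.2.1 ++ [acc.2.2])).2 = _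
    rw [h.canon.val_mkSet hl]
    refine HF.ext (HF.not_isAtom_ofList _) (HF.not_isAtom_ordinal _) fun x => ?_
    rw [HF.mem_ofList, List.map_append, List.mem_append, List.map_singleton, List.mem_singleton,
      List.mem_map, HF.mem_ordinal_iff, h.val_cur]
    constructor
    · rintro (⟨k, hk, rfl⟩ | rfl)
      · obtain ⟨j, hj, hjx⟩ := (h.val_ords _).mp ⟨k, hk, rfl⟩
        exact ⟨j, Nat.lt_succ_of_lt hj, hjx⟩
      · exact ⟨m, m.lt_succ_self, rfl⟩
    · rintro ⟨j, hj, rfl⟩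
      rcases Nat.lt_succ_iff_lt_or_eq.mp hj with hj | rfl
      · obtain ⟨k, hk, hkx⟩ := (h.val_ords _).mpr ⟨j, hj, rfl⟩
        exact Or.inl ⟨k, hk, hkx⟩
      · exact Or.inr rfl
  · intro x
    show (∃ k ∈ acc.2.1 ++ [acc.2.2], val n (ordStep n acc).1.1 k = x) ↔ _
    constructor
    · rintro ⟨k, hk, rfl⟩
      rw [hx.val_eq (hl k hk)]
      rw [List.mem_append, List.mem_singleton] at hk
      rcases hk with hk | rfl
      · obtain ⟨j, hj, hjx⟩ := (h.val_ords _).mp ⟨k, hk, rfl⟩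
        exact ⟨j, Nat.lt_succ_of_lt hj, hjx⟩
      · exact ⟨m, m.lt_succ_self, h.val_cur⟩
    · rintro ⟨j, hj, rfl⟩
      rcases Nat.lt_succ_iff_lt_or_eq.mp hj with hj | rfl
      · obtain ⟨k, hk, hkx⟩ := (h.val_ords _).mpr ⟨j, hj, rfl⟩
        exact ⟨k, List.mem_append_left _ hk, by rw [hx.val_eq (h.ords_lt k hk), hkx]⟩
      · exact ⟨acc.2.2, by simp, by rw [hx.val_eq h.cur_lt, h.val_cur]⟩

/-- The guarded ordinal loop, if its flag stays down, computes `m + |l|`. [folklore] -/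
theorem ordInv_foldCap (B : ℕ) {acc : TS × (List ℕ × ℕ)} {m : ℕ} (h : OrdInv n acc m) (l : List ℕ)
    (hf : (foldCap μO B (fun _ acc => ordStep n acc) acc l).1.2 = false) :
    OrdInv n (foldCap μO B (fun _ acc => ordStep n acc) acc l) (m + l.length) ∧
      Extends n acc.1.1 (foldCap μO B (fun _ acc => ordStep n acc) acc l).1.1 := by
  induction l generalizing acc m with
  | nil => exact ⟨h, Extends.refl h.canon⟩
  | cons a l ih =>
    obtain ⟨-, -, heq⟩ := foldCap_cons_of_flag μO B (fun _ acc => ordStep n acc) hf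
    rw [heq] at hf ⊢
    obtain ⟨h1, hx1⟩ := ordInv_ordStep h
    obtain ⟨h2, hx2⟩ := ih h1 hf
    rw [List.length_cons, ← Nat.add_assoc]
    exact ⟨by rwa [Nat.add_right_comm], hx1.trans hx2⟩

/-- **`mkOrd` is sound**: on a canonical table, if the flag is down afterwards, the returned index
denotes the von Neumann ordinal `|l|`. [folklore] -/
theorem mkOrd_sound (B : ℕ) {S : TS} (hS : Canon n S.1) (l : List ℕ) (hf : (mkOrd B n S l).1.2 = false) :
    Extends n S.1 (mkOrd B n S l).1.1 ∧ (mkOrd B n S l).2 < (mkOrd B n S l).1.1.length ∧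
      val n (mkOrd B n S l).1.1 (mkOrd B n S l).2 = HF.ordinal l.length := by
  unfold mkOrd at hf ⊢
  simp only at hf ⊢
  have hf0 : S.2 = false := flag_of_foldCap μO B _ hf
  have h0 : OrdInv n ((mk n S []).1, ([], (mk n S []).2)) 0 := by
    refine ⟨hf0, hS.canon_mkSet (by simp), snd_mkSet_lt _ _ _, by simp, ?_, ?_⟩
    · show val n (Sim.mkSet n S.1 []).1 (Sim.mkSet n S.1 []).2 = HF.ordinal 0
      rw [hS.val_mkSet (by simp), List.map_nil, HF.ordinal_zero]
      exact HF.eq_empty_of_forall_not_mem (HF.not_isAtom_ofList _) fun x hx => by simp at hx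
    · intro x; simp
  obtain ⟨hinv, hx⟩ := ordInv_foldCap B h0 l hf
  rw [Nat.zero_add] at hinv
  exact ⟨(Extends.mkSet hS (by simp)).trans hx, hinv.cur_lt, hinv.val_cur⟩

/-- Soundness at `Card t`. [folklore] -/
theorem soundT_card {t : Term} (ht : SoundT C Sd t) : SoundT C Sd (.card t) := by
  intro ρ S h hI hρ
  simp only [ev] at h ⊢
  have h1 : (ev C t ρ S).1.2 = false := by
    by_contra h1
    rw [Bool.not_eq_false] at h1
    rw [mkOrd_flag C.B C.n h1] at h
    exact Bool.false_ne_true h.symm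
  obtain ⟨hx, hi, hv⟩ := ht ρ S h1 hI hρ
  obtain ⟨hx2, hlt, hval⟩ := mkOrd_sound C.B hx.canon (elems C.n (ev C t ρ S).1.1 (ev C t ρ S).2) h
  refine ⟨hx.trans hx2, hlt, ?_⟩
  rw [hval]
  show _ = HF.card (t.eval C.G Sd (envOf C.n S.1 ρ))
  rw [← hv, HF.card, hx.canon.card_members_val hi]

/-! #### Comprehension: the guarded loop over the range -/

/-- Invariant of the comprehension loop after the member indices `done`: the table extends the
range's table `T₀`, the collected indices are valid and denote exactly the values of the head term
at the members processed so far that satisfy the guard. [folklore] -/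
structure ComprInv (C : Ctx) (Sd : DynState C.n) (v : ℕ) (t g : Term) (σ : Env C.n)
    (T₀ : List (List ℕ)) (acc : TS × List ℕ) (done : List ℕ) : Prop where
  /-- the table extends the table of the range -/
  ext : Extends C.n T₀ acc.1.1
  /-- collected indices are valid -/
  out_lt : ∀ k ∈ acc.2, k < acc.1.1.length
  /-- collected indices denote the guarded values -/
  val_out : ∀ x, (∃ k ∈ acc.2, val C.n acc.1.1 k = x) ↔
    ∃ a ∈ done, g.eval C.G Sd (Function.update σ v (val C.n T₀ a)) = HF.ofBool true ∧
      t.eval C.G Sd (Function.update σ v (val C.n T₀ a)) = x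

/-- One round of the comprehension loop keeps the invariant. [folklore] -/
theorem comprInv_step {v : ℕ} {t g : Term} (ht : SoundT C Sd t) (hg : SoundT C Sd g)
    {ρ : List (ℕ × ℕ)} {T₀ : List (List ℕ)} (hI : TInv C Sd T₀) (hρ : EnvValid T₀ ρ)
    {acc : TS × List ℕ} {done : List ℕ} (hinv : ComprInv C Sd v t g (envOf C.n T₀ ρ) T₀ acc done)
    {a : ℕ} (ha : a < T₀.length) (hf : (comprStep C v t g ρ a acc).1.2 = false) :
    ComprInv C Sd v t g (envOf C.n T₀ ρ) T₀ (comprStep C v t g ρ a acc) (done ++ [a]) := by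
  have hIa : TInv C Sd acc.1.1 := hI.of_extends hinv.ext
  have hρa : EnvValid acc.1.1 ((v, a) :: ρ) :=
    (hρ.mono hinv.ext.length_le).cons (ha.trans_le hinv.ext.length_le)
  have henv : envOf C.n acc.1.1 ((v, a) :: ρ) =
      Function.update (envOf C.n T₀ ρ) v (val C.n T₀ a) := by
    rw [envOf_cons, hinv.ext.envOf_eq hρ hI.canon, hinv.ext.val_eq ha]
  unfold comprStep at hf ⊢
  by_cases hb : isTrueIdx C.n (ev C g ((v, a) :: ρ) acc.1).2 = true
  · rw [if_pos hb] at hf ⊢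
    have hfg : (ev C g ((v, a) :: ρ) acc.1).1.2 = false := flag_of_ev C hf
    obtain ⟨hxg, hig, hvg⟩ := hg _ _ hfg hIa hρa
    obtain ⟨hxt, hit, hvt⟩ := ht _ _ hf (hIa.of_extends hxg) (hρa.mono hxg.length_le)
    rw [isTrueIdx_iff hxg.canon hig, hvg, henv] at hb
    rw [hxg.envOf_eq hρa hIa.canon, henv] at hvt
    refine ⟨hinv.ext.trans (hxg.trans hxt), ?_, fun x => ?_⟩
    · intro k hk
      simp only [List.mem_append, List.mem_singleton] at hk
      rcases hk with hk | rfl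
      · exact (hinv.out_lt k hk).trans_le (hxg.trans hxt).length_le
      · exact hit
    · simp only [List.mem_append, List.mem_singleton]
      constructor
      · rintro ⟨k, hk | rfl, rfl⟩
        · rw [(hxg.trans hxt).val_eq (hinv.out_lt k hk)]
          obtain ⟨a', ha', h'⟩ := (hinv.val_out _).mp ⟨k, hk, rfl⟩
          exact ⟨a', Or.inl ha', h'⟩
        · exact ⟨a, Or.inr rfl, hb, hvt.symm⟩
      · rintro ⟨a', ha' | rfl, hga, hta⟩
        · obtain ⟨k, hk, hkx⟩ := (hinv.val_out x).mpr ⟨a', ha', hga, hta⟩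
          exact ⟨k, Or.inl hk, by rw [(hxg.trans hxt).val_eq (hinv.out_lt k hk), hkx]⟩
        · exact ⟨_, Or.inr rfl, by rw [hvt, hta]⟩
  · rw [if_neg hb] at hf ⊢
    obtain ⟨hxg, hig, hvg⟩ := hg _ _ hf hIa hρa
    rw [isTrueIdx_iff hxg.canon hig, hvg, henv] at hb
    refine ⟨hinv.ext.trans hxg, fun k hk => (hinv.out_lt k hk).trans_le hxg.length_le, fun x => ?_⟩
    simp only [List.mem_append, List.mem_singleton]
    constructor
    · rintro ⟨k, hk, rfl⟩
      rw [hxg.val_eq (hinv.out_lt k hk)]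
      obtain ⟨a', ha', h'⟩ := (hinv.val_out _).mp ⟨k, hk, rfl⟩
      exact ⟨a', Or.inl ha', h'⟩
    · rintro ⟨a', ha' | rfl, hga, hta⟩
      · obtain ⟨k, hk, hkx⟩ := (hinv.val_out x).mpr ⟨a', ha', hga, hta⟩
        exact ⟨k, hk, by rw [hxg.val_eq (hinv.out_lt k hk), hkx]⟩
      · exact absurd hga hb

/-- The guarded comprehension loop, if its flag stays down, keeps the invariant. [folklore] -/
theorem comprInv_foldCap {v : ℕ} {t g : Term} (ht : SoundT C Sd t) (hg : SoundT C Sd g)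
    {ρ : List (ℕ × ℕ)} {T₀ : List (List ℕ)} (hI : TInv C Sd T₀) (hρ : EnvValid T₀ ρ)
    {acc : TS × List ℕ} {done : List ℕ} (hinv : ComprInv C Sd v t g (envOf C.n T₀ ρ) T₀ acc done)
    (l : List ℕ) (hl : ∀ a ∈ l, a < T₀.length)
    (hf : (foldCap μC C.B (comprStep C v t g ρ) acc l).1.2 = false) :
    ComprInv C Sd v t g (envOf C.n T₀ ρ) T₀ (foldCap μC C.B (comprStep C v t g ρ) acc l) (done ++ l) := by
  induction l generalizing acc done with
  | nil => rwa [foldCap_nil, List.append_nil]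
  | cons a l ih =>
    obtain ⟨-, -, heq⟩ := foldCap_cons_of_flag μC C.B (comprStep C v t g ρ) hf
    rw [heq] at hf ⊢
    have hfa : (comprStep C v t g ρ a acc).1.2 = false := flag_of_foldCap μC C.B _ hf
    have h1 := comprInv_step ht hg hI hρ hinv (hl a (by simp)) hfa
    have h2 := ih h1 (fun x hx => hl x (by simp [hx])) hf
    rwa [List.append_assoc, List.singleton_append] at h2

/-- Values of comprehension terms are sets. [folklore] -/
theorem not_isAtom_eval_compr (G : SimpleGraph (Fin n)) (Sd : DynState n) (v : ℕ) (t r g : Term)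
    (σ : Env n) : ¬ ((Term.compr v t r g).eval G Sd σ).IsAtom := by
  rw [Term.eval]
  exact HF.not_isAtom_ofFinset _

/-- Soundness at a comprehension term `{t : v ∈ r : g}`. [folklore] -/
theorem soundT_compr {v : ℕ} {t r g : Term} (ht : SoundT C Sd t) (hr : SoundT C Sd r)
    (hg : SoundT C Sd g) : SoundT C Sd (.compr v t r g) := by
  intro ρ S h hI hρ
  rw [ev_compr] at h ⊢
  simp only [mk_fst_fst, mk_snd, mk_flag] at h ⊢
  set rr := ev C r ρ S with hrr
  set F := foldCap μC C.B (comprStep C v t g ρ) (rr.1, []) (elems C.n rr.1.1 rr.2) with hF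
  have hfr : rr.1.2 = false := flag_of_foldCap μC C.B _ h
  obtain ⟨hxr, hir, hvr⟩ := hr ρ S hfr hI hρ
  have hIr : TInv C Sd rr.1.1 := hI.of_extends hxr
  have hρr : EnvValid rr.1.1 ρ := hρ.mono hxr.length_le
  have h0 : ComprInv C Sd v t g (envOf C.n rr.1.1 ρ) rr.1.1 (rr.1, []) [] :=
    ⟨Extends.refl hxr.canon, by simp, fun x => by simp⟩
  have hl : ∀ a ∈ elems C.n rr.1.1 rr.2, a < rr.1.1.length := fun a ha =>
    (hxr.canon.lt_of_mem_elems hir ha).trans hir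
  have hinv := comprInv_foldCap ht hg hIr hρr h0 _ hl h
  rw [List.nil_append] at hinv
  refine ⟨hxr.trans (hinv.ext.trans (Extends.mkSet hinv.ext.canon hinv.out_lt)),
    snd_mkSet_lt _ _ _, ?_⟩
  rw [hinv.ext.canon.val_mkSet hinv.out_lt]
  refine HF.ext (HF.not_isAtom_ofList _) (not_isAtom_eval_compr _ _ _ _ _ _ _) fun x => ?_
  rw [HF.mem_ofList, List.mem_map, hinv.val_out x, Term.mem_eval_compr, ← hvr,
    ← hxr.envOf_eq hρ hI.canon]
  constructor
  · rintro ⟨a, ha, hga, hta⟩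
    exact ⟨val C.n rr.1.1 a, (hxr.canon.mem_val_iff_elems hir _).mpr ⟨a, ha, rfl⟩, hga, hta⟩
  · rintro ⟨y, hy, hgy, hty⟩
    obtain ⟨a, ha, rfl⟩ := (hxr.canon.mem_val_iff_elems hir y).mp hy
    exact ⟨a, ha, hgy, hty⟩

/-! #### Argument lists, and the induction -/

/-- Soundness at the empty argument list. [folklore] -/
theorem soundA_nil : SoundA C Sd .nil := by
  intro ρ S _ hI _
  simp only [evArgs]
  exact ⟨Extends.refl hI.canon, by simp, rfl⟩

/-- Soundness at a nonempty argument list. [folklore] -/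
theorem soundA_cons {t : Term} {rest : Args} (ht : SoundT C Sd t) (hr : SoundA C Sd rest) :
    SoundA C Sd (.cons t rest) := by
  intro ρ S h hI hρ
  simp only [evArgs] at h ⊢
  have h1 : (ev C t ρ S).1.2 = false := flag_of_evArgs C h
  obtain ⟨hx1, hi1, hv1⟩ := ht ρ S h1 hI hρ
  obtain ⟨hx2, hk2, hv2⟩ := hr ρ _ h (hI.of_extends hx1) (hρ.mono hx1.length_le)
  refine ⟨hx1.trans hx2, ?_, ?_⟩
  · intro k hk
    simp only [List.mem_cons] at hk
    rcases hk with rfl | hk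
    · exact hi1.trans_le hx2.length_le
    · exact hk2 k hk
  · rw [List.map_cons, hx2.val_eq hi1, hv1, hv2, hx1.envOf_eq hρ hI.canon]
    rfl

variable (C Sd)

mutual
/-- **Soundness of the evaluator** (all terms). [Blass–Gurevich–Shelah 1999, §4.4, §5.2 Thm 1
("the desired Turing machine simulates the given PTime program")] [folklore] -/
theorem ev_sound : ∀ t : Term, SoundT C Sd t
  | .var v => soundT_var v
  | .empty => soundT_empty
  | .atoms => soundT_atoms
  | .sUnion t => soundT_sUnion (ev_sound t)
  | .theUnique t => soundT_theUnique (ev_sound t)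
  | .pair s t => soundT_pair (ev_sound s) (ev_sound t)
  | .card t => soundT_card (ev_sound t)
  | .mem s t => soundT_mem (ev_sound s) (ev_sound t)
  | .eq s t => soundT_eq (ev_sound s) (ev_sound t)
  | .cTrue => soundT_cTrue
  | .cFalse => soundT_cFalse
  | .not t => soundT_not (ev_sound t)
  | .and s t => soundT_and (ev_sound s) (ev_sound t)
  | .or s t => soundT_or (ev_sound s) (ev_sound t)
  | .edge s t => soundT_edge (ev_sound s) (ev_sound t)
  | .dyn _ args => soundT_dyn (evArgs_sound args)
  | .compr _ t r g => soundT_compr (ev_sound t) (ev_sound r) (ev_sound g)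
/-- Soundness of the evaluator on argument lists. [folklore] -/
theorem evArgs_sound : ∀ a : Args, SoundA C Sd a
  | .nil => soundA_nil
  | .cons t rest => soundA_cons (ev_sound t) (evArgs_sound rest)
end

end Sound

/-! ### Soundness of rules -/

/-- Decoding a coded update over the table `T`. [folklore] -/
def decodeUp (n : ℕ) (T : List (List ℕ)) (c : CUpdate) : Update n :=
  ((c.1.1, c.1.2.map (val n T)), val n T c.2)

/-- Coded updates are VALID for `T`: all indices are valid. [folklore] -/
def UValid (T : List (List ℕ)) (ups : List CUpdate) : Prop :=
  ∀ c ∈ ups, c.2 < T.length ∧ ∀ k ∈ c.1.2, k < T.length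

/-- Validity is monotone in the table. [folklore] -/
theorem UValid.mono {T T' : List (List ℕ)} {ups : List CUpdate} (h : UValid T ups)
    (hle : T.length ≤ T'.length) : UValid T' ups := fun c hc =>
  ⟨(h c hc).1.trans_le hle, fun k hk => ((h c hc).2 k hk).trans_le hle⟩

/-- Concatenation of valid update lists. [folklore] -/
theorem UValid.append {T : List (List ℕ)} {u₁ u₂ : List CUpdate} (h₁ : UValid T u₁) (h₂ : UValid T u₂) :
    UValid T (u₁ ++ u₂) := fun c hc => (List.mem_append.mp hc).elim (h₁ c) (h₂ c)

/-- Decoding is stable under table extension. [folklore] -/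
theorem Extends.decodeUp_eq {T T' : List (List ℕ)} (h : Extends n T T') {c : CUpdate}
    (hc : c.2 < T.length ∧ ∀ k ∈ c.1.2, k < T.length) : decodeUp n T' c = decodeUp n T c := by
  unfold decodeUp
  rw [h.map_val_eq hc.2, h.val_eq hc.1]

section SoundRules

variable (C : Ctx) (Sd : DynState C.n)

/-- **Soundness of `den` at the rule `R`**: if the flag is down afterwards, the table was extended
canonically, the coded updates are valid and decode exactly to the update set `Rule.den`.
[folklore] -/
def SoundR (R : Rule) : Prop :=
  ∀ (ρ : List (ℕ × ℕ)) (S : TS), (den C R ρ S).1.2 = false → TInv C Sd S.1 → EnvValid S.1 ρ →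
    Extends C.n S.1 (den C R ρ S).1.1 ∧ UValid (den C R ρ S).1.1 (den C R ρ S).2 ∧
      ∀ u, u ∈ R.den C.G Sd (envOf C.n S.1 ρ) ↔ ∃ c ∈ (den C R ρ S).2, decodeUp C.n (den C R ρ S).1.1 c = u

variable {C Sd}

/-- Soundness at `Skip`. [folklore] -/
theorem soundR_skip : SoundR C Sd .skip := by
  intro ρ S _ hI _
  simp only [den]
  refine ⟨Extends.refl hI.canon, fun c hc => by simp at hc, fun u => ?_⟩
  simp [Rule.den]

/-- Soundness at an update rule `f(args) := t`. [folklore] -/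
theorem soundR_update (f : ℕ) (args : Args) (t : Term) : SoundR C Sd (.update f args t) := by
  intro ρ S h hI hρ
  simp only [den] at h ⊢
  have h1 : (evArgs C args ρ S).1.2 = false := flag_of_ev C h
  obtain ⟨hx1, hk1, hv1⟩ := evArgs_sound C Sd args ρ S h1 hI hρ
  obtain ⟨hx2, hi2, hv2⟩ := ev_sound C Sd t ρ _ h (hI.of_extends hx1) (hρ.mono hx1.length_le)
  refine ⟨hx1.trans hx2, fun c hc => ?_, fun u => ?_⟩
  · simp only [List.mem_singleton] at hc
    subst hc
    exact ⟨hi2, fun k hk => (hk1 k hk).trans_le hx2.length_le⟩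
  · simp only [Rule.den, Finset.mem_singleton, List.mem_singleton, exists_eq_left]
    rw [decodeUp, hx2.map_val_eq hk1, hv1, hv2, hx1.envOf_eq hρ hI.canon]
    exact eq_comm

/-- Soundness at a conditional rule. [folklore] -/
theorem soundR_cond {g : Term} {R₁ R₂ : Rule} (h₁ : SoundR C Sd R₁) (h₂ : SoundR C Sd R₂) :
    SoundR C Sd (.cond g R₁ R₂) := by
  intro ρ S h hI hρ
  simp only [den] at h ⊢
  have hfg : (ev C g ρ S).1.2 = false := by
    split at h
    · exact flag_of_den C h
    · exact flag_of_den C h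
  obtain ⟨hxg, hig, hvg⟩ := ev_sound C Sd g ρ S hfg hI hρ
  have hcond : (Rule.cond g R₁ R₂).den C.G Sd (envOf C.n S.1 ρ) =
      if isTrueIdx C.n (ev C g ρ S).2 = true then R₁.den C.G Sd (envOf C.n S.1 ρ)
      else R₂.den C.G Sd (envOf C.n S.1 ρ) := by
    simp only [Rule.den]
    congr 1
    exact propext ((isTrueIdx_iff hxg.canon hig).trans (by rw [hvg])).symm
  rw [hcond]
  by_cases hb : isTrueIdx C.n (ev C g ρ S).2 = true
  · simp only [if_pos hb] at h ⊢
    obtain ⟨hx, hv, hiff⟩ := h₁ ρ _ h (hI.of_extends hxg) (hρ.mono hxg.length_le)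
    rw [hxg.envOf_eq hρ hI.canon] at hiff
    exact ⟨hxg.trans hx, hv, hiff⟩
  · simp only [if_neg hb] at h ⊢
    obtain ⟨hx, hv, hiff⟩ := h₂ ρ _ h (hI.of_extends hxg) (hρ.mono hxg.length_le)
    rw [hxg.envOf_eq hρ hI.canon] at hiff
    exact ⟨hxg.trans hx, hv, hiff⟩

/-- Invariant of the `do forall` loop after the member indices `done`. [folklore] -/
structure ForallInv (C : Ctx) (Sd : DynState C.n) (v : ℕ) (R : Rule) (σ : Env C.n)
    (T₀ : List (List ℕ)) (acc : TS × List CUpdate) (done : List ℕ) : Prop where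
  /-- the table extends the table of the range -/
  ext : Extends C.n T₀ acc.1.1
  /-- collected updates are valid -/
  valid : UValid acc.1.1 acc.2
  /-- collected updates decode to the update sets of the processed rounds -/
  mem_iff : ∀ u, (∃ c ∈ acc.2, decodeUp C.n acc.1.1 c = u) ↔
    ∃ a ∈ done, u ∈ R.den C.G Sd (Function.update σ v (val C.n T₀ a))

/-- One round of the `do forall` loop keeps the invariant. [folklore] -/
theorem forallInv_step {v : ℕ} {R : Rule} (hR : SoundR C Sd R) {ρ : List (ℕ × ℕ)}
    {T₀ : List (List ℕ)} (hI : TInv C Sd T₀) (hρ : EnvValid T₀ ρ) {acc : TS × List CUpdate}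
    {done : List ℕ} (hinv : ForallInv C Sd v R (envOf C.n T₀ ρ) T₀ acc done) {a : ℕ}
    (ha : a < T₀.length) (hf : (forallStep C v R ρ a acc).1.2 = false) :
    ForallInv C Sd v R (envOf C.n T₀ ρ) T₀ (forallStep C v R ρ a acc) (done ++ [a]) := by
  have hIa : TInv C Sd acc.1.1 := hI.of_extends hinv.ext
  have hρa : EnvValid acc.1.1 ((v, a) :: ρ) :=
    (hρ.mono hinv.ext.length_le).cons (ha.trans_le hinv.ext.length_le)
  have henv : envOf C.n acc.1.1 ((v, a) :: ρ) =
      Function.update (envOf C.n T₀ ρ) v (val C.n T₀ a) := by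
    rw [envOf_cons, hinv.ext.envOf_eq hρ hI.canon, hinv.ext.val_eq ha]
  unfold forallStep at hf ⊢
  obtain ⟨hx, hv, hiff⟩ := hR _ _ hf hIa hρa
  rw [henv] at hiff
  refine ⟨hinv.ext.trans hx, (hinv.valid.mono hx.length_le).append hv, fun u => ?_⟩
  simp only [List.mem_append, List.mem_singleton]
  constructor
  · rintro ⟨c, hc | hc, rfl⟩
    · rw [hx.decodeUp_eq (hinv.valid c hc)]
      obtain ⟨a', ha', h'⟩ := (hinv.mem_iff _).mp ⟨c, hc, rfl⟩
      exact ⟨a', Or.inl ha', h'⟩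
    · exact ⟨a, Or.inr rfl, (hiff _).mpr ⟨c, hc, rfl⟩⟩
  · rintro ⟨a', ha' | rfl, hu⟩
    · obtain ⟨c, hc, hcu⟩ := (hinv.mem_iff u).mpr ⟨a', ha', hu⟩
      exact ⟨c, Or.inl hc, by rw [hx.decodeUp_eq (hinv.valid c hc), hcu]⟩
    · obtain ⟨c, hc, hcu⟩ := (hiff u).mp hu
      exact ⟨c, Or.inr hc, hcu⟩

/-- The guarded `do forall` loop, if its flag stays down, keeps the invariant. [folklore] -/
theorem forallInv_foldCap {v : ℕ} {R : Rule} (hR : SoundR C Sd R) {ρ : List (ℕ × ℕ)}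
    {T₀ : List (List ℕ)} (hI : TInv C Sd T₀) (hρ : EnvValid T₀ ρ) {acc : TS × List CUpdate}
    {done : List ℕ} (hinv : ForallInv C Sd v R (envOf C.n T₀ ρ) T₀ acc done) (l : List ℕ)
    (hl : ∀ a ∈ l, a < T₀.length) (hf : (foldCap μU C.B (forallStep C v R ρ) acc l).1.2 = false) :
    ForallInv C Sd v R (envOf C.n T₀ ρ) T₀ (foldCap μU C.B (forallStep C v R ρ) acc l) (done ++ l) := by
  induction l generalizing acc done with
  | nil => rwa [foldCap_nil, List.append_nil]
  | cons a l ih =>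
    obtain ⟨-, -, heq⟩ := foldCap_cons_of_flag μU C.B (forallStep C v R ρ) hf
    rw [heq] at hf ⊢
    have hfa : (forallStep C v R ρ a acc).1.2 = false := flag_of_foldCap μU C.B _ hf
    have h1 := forallInv_step hR hI hρ hinv (hl a (by simp)) hfa
    have h2 := ih h1 (fun x hx => hl x (by simp [hx])) hf
    rwa [List.append_assoc, List.singleton_append] at h2

/-- Soundness at a `do forall` rule. [folklore] -/
theorem soundR_forallDo {v : ℕ} {r : Term} {R : Rule} (hR : SoundR C Sd R) :
    SoundR C Sd (.forallDo v r R) := by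
  intro ρ S h hI hρ
  rw [den_forallDo] at h ⊢
  set rr := ev C r ρ S with hrr
  have hfr : rr.1.2 = false := flag_of_foldCap μU C.B _ h
  obtain ⟨hxr, hir, hvr⟩ := ev_sound C Sd r ρ S hfr hI hρ
  have hIr : TInv C Sd rr.1.1 := hI.of_extends hxr
  have hρr : EnvValid rr.1.1 ρ := hρ.mono hxr.length_le
  have h0 : ForallInv C Sd v R (envOf C.n rr.1.1 ρ) rr.1.1 (rr.1, []) [] :=
    ⟨Extends.refl hxr.canon, fun c hc => by simp at hc, fun u => by simp⟩
  have hl : ∀ a ∈ elems C.n rr.1.1 rr.2, a < rr.1.1.length := fun a ha =>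
    (hxr.canon.lt_of_mem_elems hir ha).trans hir
  have hinv := forallInv_foldCap hR hIr hρr h0 _ hl h
  rw [List.nil_append] at hinv
  refine ⟨hxr.trans hinv.ext, hinv.valid, fun u => ?_⟩
  rw [hinv.mem_iff u]
  simp only [Rule.den, Finset.mem_biUnion, HF.mem_members]
  rw [← hvr, ← hxr.envOf_eq hρ hI.canon]
  constructor
  · rintro ⟨y, hy, hu⟩
    obtain ⟨a, ha, rfl⟩ := (hxr.canon.mem_val_iff_elems hir y).mp hy
    exact ⟨a, ha, hu⟩
  · rintro ⟨a, ha, hu⟩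
    exact ⟨_, (hxr.canon.mem_val_iff_elems hir _).mpr ⟨a, ha, rfl⟩, hu⟩

variable (C Sd)

/-- **Soundness of `den`** (all rules). [Blass–Gurevich–Shelah 1999, §4.5–4.6, §5.2 Thm 1]
[folklore] -/
theorem den_sound : ∀ R : Rule, SoundR C Sd R
  | .skip => soundR_skip
  | .update f args t => soundR_update f args t
  | .cond _ R₁ R₂ => soundR_cond (den_sound R₁) (den_sound R₂)
  | .forallDo _ _ R => soundR_forallDo (den_sound R)

end SoundRules

/-! ### Soundness of firing -/

/-- Consistency of coded updates, unfolded. [folklore] -/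
theorem consistentB_eq_true_iff (ups : List CUpdate) :
    consistentB ups = true ↔ ∀ c ∈ ups, ∀ c' ∈ ups, c.1 = c'.1 → c.2 = c'.2 := by
  simp only [consistentB, List.all_eq_true, Bool.or_eq_true, Bool.not_eq_true', beq_eq_false_iff_ne,
    ne_eq, beq_iff_eq]
  exact forall₄_congr fun c _ c' _ => or_iff_not_imp_left.trans (by simp only [not_not])

section Fire

variable {T : List (List ℕ)} {srep ups : List CUpdate} {Sd : DynState n} {U : Finset (Update n)}

/-- Coded updates with the same decoded location have the same coded location. [folklore] -/
theorem loc_eq_of_decodeUp (hT : Canon n T) {c c' : CUpdate} (hc : c.2 < T.length ∧ ∀ k ∈ c.1.2, k < T.length)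
    (hc' : c'.2 < T.length ∧ ∀ k ∈ c'.1.2, k < T.length)
    (h : (decodeUp n T c).1 = (decodeUp n T c').1) : c.1 = c'.1 := by
  simp only [decodeUp, Prod.mk.injEq] at h
  exact Prod.ext h.1 (hT.map_val_inj hc.2 hc'.2 h.2)

/-- **The coded consistency test decides consistency** of the decoded update set. [folklore] -/
theorem consistentB_iff (hT : Canon n T) (hv : UValid T ups)
    (hU : ∀ u, u ∈ U ↔ ∃ c ∈ ups, decodeUp n T c = u) : consistentB ups = true ↔ Consistent U := by
  rw [consistentB_eq_true_iff]
  constructor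
  · intro h u hu u' hu' heq
    obtain ⟨c, hc, rfl⟩ := (hU u).mp hu
    obtain ⟨c', hc', rfl⟩ := (hU u').mp hu'
    have hloc := loc_eq_of_decodeUp hT (hv c hc) (hv c' hc') heq
    show val n T c.2 = val n T c'.2
    rw [h c hc c' hc' hloc]
  · intro h c hc c' hc' hloc
    have heq := h _ ((hU _).mpr ⟨c, hc, rfl⟩) _ ((hU _).mpr ⟨c', hc', rfl⟩)
      (by simp only [decodeUp, hloc])
    exact hT.inj _ _ (hv c hc).1 (hv c' hc').1 heq

/-- Membership in the fired coded state (consistent case). [folklore] -/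
theorem mem_fireS_iff (hcons : consistentB ups = true) (e : CUpdate) :
    e ∈ fireS n srep ups ↔ (e ∈ ups ∧ e.2 ≠ n) ∨ (e ∈ srep ∧ ∀ c ∈ ups, c.1 ≠ e.1) := by
  rw [fireS, if_pos hcons, List.mem_append, List.mem_filter, List.mem_filter]
  simp only [Bool.not_eq_true', beq_eq_false_iff_ne, ne_eq, List.any_eq_false, beq_iff_eq]

/-- **Firing coded updates realises `fire`**: the fired coded state represents the fired
dynamic state. [Blass–Gurevich–Shelah 1999, §4.6] [folklore] -/
theorem srel_fireS (hT : Canon n T) (hs : SRel n T srep Sd) (hv : UValid T ups)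
    (hU : ∀ u, u ∈ U ↔ ∃ c ∈ ups, decodeUp n T c = u) : SRel n T (fireS n srep ups) (fire Sd U) := by
  by_cases hcons : consistentB ups = true
  · have hC : Consistent U := (consistentB_iff hT hv hU).mp hcons
    -- old entries whose location is not updated keep their value
    have hkeep : ∀ e ∈ srep, (∀ c ∈ ups, c.1 ≠ e.1) →
        ∀ b, ((e.1.1, e.1.2.map (val n T)), b) ∉ U := by
      intro e he hne b hb
      obtain ⟨c, hc, hcu⟩ := (hU _).mp hb
      refine hne c hc (loc_eq_of_decodeUp hT (hv c hc) ⟨hs.val_lt e he, hs.args_lt e he⟩ ?_)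
      rw [hcu]
      rfl
    refine ⟨fun e he => ?_, fun e he => ?_, fun e he => ?_, fun e he => ?_, fun f args hf => ?_⟩
    · rcases (mem_fireS_iff hcons e).mp he with ⟨he, -⟩ | ⟨he, -⟩
      · exact (hv e he).1
      · exact hs.val_lt e he
    · rcases (mem_fireS_iff hcons e).mp he with ⟨he, -⟩ | ⟨he, -⟩
      · exact (hv e he).2
      · exact hs.args_lt e he
    · rcases (mem_fireS_iff hcons e).mp he with ⟨-, hne⟩ | ⟨he, -⟩
      · exact hne
      · exact hs.val_ne e he
    · rcases (mem_fireS_iff hcons e).mp he with ⟨he, -⟩ | ⟨he, hne⟩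
      · exact fire_apply_of_mem hC ((hU _).mpr ⟨e, he, rfl⟩)
      · rw [fire_apply_of_forall_not_mem (hkeep e he hne)]
        exact hs.apply_eq e he
    · by_cases hex : ∃ b, ((f, args), b) ∈ U
      · obtain ⟨b, hb⟩ := hex
        rw [fire_apply_of_mem hC hb] at hf
        obtain ⟨c, hc, hcu⟩ := (hU _).mp hb
        simp only [decodeUp, Prod.mk.injEq] at hcu
        obtain ⟨⟨rfl, rfl⟩, rfl⟩ := hcu
        refine ⟨c, (mem_fireS_iff hcons c).mpr (Or.inl ⟨hc, fun h => hf ?_⟩), rfl, rfl⟩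
        rw [h, hT.val_n]
      · rw [fire_apply_of_forall_not_mem (not_exists.mp hex)] at hf
        obtain ⟨e, he, rfl, hargs⟩ := hs.complete f args hf
        refine ⟨e, (mem_fireS_iff hcons e).mpr (Or.inr ⟨he, fun c hc hce => hex ⟨val n T c.2, ?_⟩⟩),
          rfl, hargs⟩
        rw [← hargs]
        refine (hU _).mpr ⟨c, hc, ?_⟩
        simp only [decodeUp, hce]
  · have hC : ¬ Consistent U := fun h => hcons ((consistentB_iff hT hv hU).mpr h)
    rw [fire_of_not_consistent hC, fireS, if_neg hcons]
    exact hs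

end Fire

end Literature.ModelTheory.FiniteModelTheory.BGS.Sim
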